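import Literature.NumberTheory.GaloisRepresentations.CyclicLayerCarry
import HarnessLib

/-!
# Restriction of cyclic classes along a homomorphism (Serre, *Corps locaux* XIII §3, XIV §1)

Complements to `CyclicLayerCarry.lean`.  For a cyclic layer `χ : G → ℤ/n` and a continuous
homomorphism `φ : H → G` (e.g. the inclusion of a closed subgroup), the composite `χ ∘ φ` need
not be onto: its image is the subgroup of `ℤ/n` of some order `e ∣ n`, i.e. `(n/e)ℤ/nℤ`, and
`χ ∘ φ = (n/e) · ψ` for a unique cyclic layer `ψ : H → ℤ/e`, the **derived character**
(`CyclicCharacter.derived`).  The carry cocycles agree: `c_χ(φ σ, φ τ) = c_ψ(σ, τ)`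
(`carryFun_derived`), so the restriction of a cyclic class `κ_χ(a)` along `φ` is the cyclic class
`κ_ψ(a)` (`map_cyclicClass_eq_cyclicClass_derived`).  This is the cocycle-level form of the
formula `inv_L ∘ res = [L : K] · inv_K` for the restriction of Brauer classes to a subfield of
degree `[L : K]` meeting the unramified tower in degree `n/e`.

Also: `d · κ_χ(a) = 0` (`nsmul_cyclicClass_eq_zero`: `d · a = N_s a` for an invariant `a`, and
`κ(N_s b) = 0`), and the index of the kernel of a cyclic layer (`CyclicCharacter.index_ker`).

## References
* J.-P. Serre, *Corps locaux*, Hermann, 1968, XIII §3 (Prop. 7), XIV §1. [SerreLocalFields1979]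
* J.-P. Serre, *Galois Cohomology*, Springer, 1997, I §2.4. [SerreGaloisCohomology1997]
-/

noncomputable section

open CategoryTheory Function

universe u

namespace Literature.NumberTheory.GaloisRepresentations

open _root_.TopRep _root_.ContRepresentation _root_.ContinuousCohomology

/-! ### Torsion of cyclic classes -/

section Torsion

variable {G : Type u} [Group G] [TopologicalSpace G]
variable {A : Type u} [AddCommGroup A] [TopologicalSpace A]

/-- `N_s a = d · a` for a `G`-invariant `a`. [folklore] -/
theorem ContinuousRep.cycNorm_eq_nsmul (ρ : ContinuousRep G ℤ A) (s : G) (d : ℕ) {a : A}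
    (ha : ∀ g, ρ g a = a) : ρ.cycNorm s d a = d • a := by
  unfold ContinuousRep.cycNorm ContinuousRep.powSum
  rw [Finset.sum_congr rfl fun k _ => ha (s ^ k), Finset.sum_const, Finset.card_range]

variable [IsTopologicalGroup G] [LocallyCompactSpace G] [DiscreteTopology A]
variable {d : ℕ} [NeZero d] (χ : CyclicCharacter G d) (ρ : ContinuousRep G ℤ A)

/-- **`d · κ_χ(a) = 0`**: the cyclic class of a `G`-invariant is killed by the order `d` of the
layer (`d · a = N_s a` and `κ(N_s b) = 0`, `cyclicClass_cycNorm`).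
[cite: SerreLocalFields1979, XIII §3] -/
theorem nsmul_cyclicClass_eq_zero (a : ρ.toTopRep.ρ.invariants) : d • cyclicClass χ ρ a = 0 := by
  obtain ⟨s, hs⟩ := χ.exists_map_eq_one
  have ha : ∀ g, ρ g (a : A) = a := a.2
  have hb : ∀ t ∈ χ.ker, ρ t (a : A) = a := fun t _ => ha t
  have heq : (⟨ρ.cycNorm s d (a : A), apply_cycNorm_eq χ ρ hs hb⟩ : ρ.toTopRep.ρ.invariants) =
      d • a := Subtype.ext (by
    rw [AddSubmonoidClass.coe_nsmul]
    exact ρ.cycNorm_eq_nsmul s d ha)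
  have h := cyclicClass_cycNorm χ ρ hs hb
  rwa [heq, map_nsmul] at h

end Torsion

/-! ### Subgroups of `ℤ/n` -/

section ZModSub

variable {n : ℕ} [NeZero n]

omit [NeZero n] in
/-- The order of a subgroup of `ℤ/n` divides `n`. [folklore] -/
theorem natCard_addSubgroup_zmod_dvd (R : AddSubgroup (ZMod n)) : Nat.card R ∣ n := by
  have h := R.card_addSubgroup_dvd_card
  rwa [Nat.card_zmod] at h

/-- The order of a subgroup of `ℤ/n` is positive. [folklore] -/
theorem natCard_addSubgroup_zmod_pos (R : AddSubgroup (ZMod n)) : 0 < Nat.card R := Nat.card_pos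

/-- **Elements of a subgroup of `ℤ/n` of order `e` are multiples of `n/e`** (as natural numbers
`< n`): `e · x = 0` gives `n ∣ e · val x`. [folklore] -/
theorem div_natCard_dvd_val {R : AddSubgroup (ZMod n)} {x : ZMod n} (hx : x ∈ R) :
    n / Nat.card R ∣ x.val := by
  have he : Nat.card R • x = 0 := by
    have h := card_nsmul_eq_zero' (G := R) (x := ⟨x, hx⟩)
    exact congrArg Subtype.val h
  have hn : n ∣ Nat.card R * x.val := by
    rw [← ZMod.natCast_eq_zero_iff, Nat.cast_mul, ZMod.natCast_zmod_val, ← nsmul_eq_mul]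
    exact he
  have hpos := natCard_addSubgroup_zmod_pos R
  have h1 : n / Nat.card R * Nat.card R ∣ x.val * Nat.card R := by
    rw [Nat.div_mul_cancel (natCard_addSubgroup_zmod_dvd R), mul_comm]
    exact hn
  exact Nat.dvd_of_mul_dvd_mul_right hpos h1

end ZModSub

/-! ### The derived character of a restriction -/

namespace CyclicCharacter

variable {G : Type u} [Group G] [TopologicalSpace G] {H : Type u} [Group H] [TopologicalSpace H]
variable {n : ℕ} [NeZero n] (χ : CyclicCharacter G n) (φ : H →ₜ* G)

/-- The image of `χ ∘ φ`, a subgroup of `ℤ/n`. [folklore] -/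
def compRange : AddSubgroup (ZMod n) where
  carrier := Set.range fun h => χ (φ h)
  add_mem' := by
    rintro _ _ ⟨a, rfl⟩ ⟨b, rfl⟩
    exact ⟨a * b, by change χ (φ (a * b)) = χ (φ a) + χ (φ b); rw [_root_.map_mul φ, χ.map_mul]⟩
  zero_mem' := ⟨1, by change χ (φ 1) = 0; rw [_root_.map_one φ, χ.map_one]⟩
  neg_mem' := by
    rintro _ ⟨a, rfl⟩
    exact ⟨a⁻¹, by change χ (φ a⁻¹) = -χ (φ a); rw [_root_.map_inv φ, χ.map_inv]⟩

omit [NeZero n] in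
/-- `χ (φ h)` lies in the image. [folklore] -/
theorem apply_mem_compRange (h : H) : χ (φ h) ∈ χ.compRange φ := ⟨h, rfl⟩

/-- **The order `e` of the image of `χ ∘ φ`** (for `φ` the inclusion `Γ_L ≤ Γ_K` and `χ` the
character of the unramified extension `K_n/K`: `e = [L K_n : L]`). [folklore] -/
def compOrder : ℕ := Nat.card (χ.compRange φ)

omit [NeZero n] in
/-- `e ∣ n`. [folklore] -/
theorem compOrder_dvd : χ.compOrder φ ∣ n := natCard_addSubgroup_zmod_dvd _

/-- `0 < e`. [folklore] -/
theorem compOrder_pos : 0 < χ.compOrder φ := natCard_addSubgroup_zmod_pos _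

/-- `e` is not zero. [folklore] -/
instance neZero_compOrder : NeZero (χ.compOrder φ) := ⟨(χ.compOrder_pos φ).ne'⟩

/-- The cofactor `m = n / e`. [folklore] -/
def compCofactor : ℕ := n / χ.compOrder φ

omit [NeZero n] in
/-- `m · e = n`. [folklore] -/
theorem compCofactor_mul_compOrder : χ.compCofactor φ * χ.compOrder φ = n :=
  Nat.div_mul_cancel (χ.compOrder_dvd φ)

/-- `0 < m`. [folklore] -/
theorem compCofactor_pos : 0 < χ.compCofactor φ :=
  Nat.div_pos (Nat.le_of_dvd (NeZero.pos n) (χ.compOrder_dvd φ)) (χ.compOrder_pos φ)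

/-- **The values of `χ ∘ φ` are multiples of `m = n/e`.** [folklore] -/
theorem compCofactor_dvd_val (h : H) : χ.compCofactor φ ∣ (χ (φ h)).val :=
  div_natCard_dvd_val (χ.apply_mem_compRange φ h)

/-- The quotient `q(h) = val(χ(φ h)) / m`. [folklore] -/
def compQuot (h : H) : ℕ := (χ (φ h)).val / χ.compCofactor φ

/-- `val(χ(φ h)) = m · q(h)`. [folklore] -/
theorem val_apply_eq (h : H) : (χ (φ h)).val = χ.compCofactor φ * χ.compQuot φ h :=
  (Nat.mul_div_cancel' (χ.compCofactor_dvd_val φ h)).symm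

/-- `q(h) < e`. [folklore] -/
theorem compQuot_lt (h : H) : χ.compQuot φ h < χ.compOrder φ := by
  have hlt : χ.compCofactor φ * χ.compQuot φ h < χ.compCofactor φ * χ.compOrder φ := by
    rw [χ.compCofactor_mul_compOrder φ, ← val_apply_eq]
    exact ZMod.val_lt _
  exact Nat.lt_of_mul_lt_mul_left hlt

/-- `q(h h') ≡ q(h) + q(h') (mod e)`. [folklore] -/
theorem compQuot_mul (h h' : H) :
    χ.compQuot φ (h * h') = (χ.compQuot φ h + χ.compQuot φ h') % χ.compOrder φ := by
  have hm := χ.compCofactor_pos φ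
  apply Nat.eq_of_mul_eq_mul_left hm
  rw [← Nat.mul_mod_mul_left, χ.compCofactor_mul_compOrder φ, ← val_apply_eq, _root_.map_mul φ,
    χ.map_mul, ZMod.val_add, val_apply_eq, val_apply_eq, mul_add]

/-- **The derived character `ψ : H → ℤ/e` of `χ ∘ φ`**, `ψ(h) = val(χ(φ h)) / m (mod e)`, so that
`χ ∘ φ = m · ψ`; it is onto (the image of `χ ∘ φ` has exactly `e` elements, all multiples of `m`).
[cite: SerreLocalFields1979, XIII §3 (proof of Prop. 7)] -/
def derived : CyclicCharacter H (χ.compOrder φ) where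
  toFun h := ((χ.compQuot φ h : ℕ) : ZMod (χ.compOrder φ))
  map_mul' h h' := by
    rw [compQuot_mul, ZMod.natCast_mod, Nat.cast_add]
  continuous_toFun :=
    (continuous_of_discreteTopology (f := fun x : ZMod n =>
      (((x.val / χ.compCofactor φ : ℕ) : ZMod (χ.compOrder φ))))).comp (χ.continuous.comp φ.continuous)
  surjective' := by
    classical
    -- `x ↦ val x / m` is injective on the image, hence bijective onto `ℤ/e`
    let g : χ.compRange φ → ZMod (χ.compOrder φ) := fun x =>
      (((x : ZMod n).val / χ.compCofactor φ : ℕ) : ZMod (χ.compOrder φ))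
    have hval : ∀ x : χ.compRange φ, (x : ZMod n).val =
        χ.compCofactor φ * ((x : ZMod n).val / χ.compCofactor φ) := fun x =>
      (Nat.mul_div_cancel' (div_natCard_dvd_val x.2)).symm
    have hlt : ∀ x : χ.compRange φ, (x : ZMod n).val / χ.compCofactor φ < χ.compOrder φ := by
      intro x
      have h1 : χ.compCofactor φ * ((x : ZMod n).val / χ.compCofactor φ) <
          χ.compCofactor φ * χ.compOrder φ := by
        rw [χ.compCofactor_mul_compOrder φ, ← hval x]
        exact ZMod.val_lt _
      exact Nat.lt_of_mul_lt_mul_left h1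
    have hg : Injective g := by
      intro x y hxy
      have h1 := congrArg ZMod.val hxy
      simp only [g, ZMod.val_cast_of_lt (hlt x), ZMod.val_cast_of_lt (hlt y)] at h1
      apply Subtype.ext
      apply ZMod.val_injective
      rw [hval x, hval y, h1]
    have hbij : Bijective g := hg.bijective_of_nat_card_le (by rw [Nat.card_zmod]; rfl)
    intro i
    obtain ⟨⟨x, ⟨h, rfl⟩⟩, hx⟩ := hbij.2 i
    exact ⟨h, hx⟩

/-- Unfolding `derived`. [folklore] -/
theorem derived_apply (h : H) :
    χ.derived φ h = ((χ.compQuot φ h : ℕ) : ZMod (χ.compOrder φ)) := rfl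

/-- `val (ψ h) = q(h)`. [folklore] -/
theorem val_derived (h : H) : (χ.derived φ h).val = χ.compQuot φ h := by
  rw [derived_apply, ZMod.val_cast_of_lt (χ.compQuot_lt φ h)]

/-- **`χ ∘ φ = m · ψ` on values.** [folklore] -/
theorem val_apply_eq_mul_val_derived (h : H) :
    (χ (φ h)).val = χ.compCofactor φ * (χ.derived φ h).val := by
  rw [val_derived, val_apply_eq]

/-- **The kernel of the derived character is `φ⁻¹(ker χ)`.** [folklore] -/
theorem ker_derived : (χ.derived φ).ker = χ.ker.comap (φ : H →* G) := by
  ext h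
  rw [CyclicCharacter.mem_ker, Subgroup.mem_comap, CyclicCharacter.mem_ker]
  change χ.derived φ h = 0 ↔ χ (φ h) = 0
  rw [← ZMod.val_eq_zero, val_derived, ← ZMod.val_eq_zero (χ _), val_apply_eq]
  constructor
  · intro h0
    rw [h0, mul_zero]
  · intro h0
    exact (Nat.mul_eq_zero.1 h0).resolve_left (χ.compCofactor_pos φ).ne'

/-- **The carry cocycles agree: `c_χ(φ σ, φ τ) = c_ψ(σ, τ)`** (`(m a + m b) / (m e) = (a + b) / e`).
[cite: SerreLocalFields1979, XIII §3] -/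
theorem carryFun_derived (σ τ : H) :
    χ.carryFun (φ σ) (φ τ) = (χ.derived φ).carryFun σ τ := by
  unfold CyclicCharacter.carryFun
  rw [val_apply_eq_mul_val_derived, val_apply_eq_mul_val_derived, ← mul_add,
    ← Nat.mul_div_mul_left ((χ.derived φ σ).val + (χ.derived φ τ).val) (χ.compOrder φ)
      (χ.compCofactor_pos φ), χ.compCofactor_mul_compOrder φ]

/-- The `ℤ/d`-valued character as a homomorphism to `Multiplicative (ℤ/d)`. [folklore] -/
def toMonoidHom {d : ℕ} (θ : CyclicCharacter G d) : G →* Multiplicative (ZMod d) where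
  toFun g := Multiplicative.ofAdd (θ g)
  map_one' := by rw [θ.map_one]; rfl
  map_mul' a b := by rw [θ.map_mul]; rfl

/-- **The kernel of a cyclic layer `G → ℤ/d` has index `d`.** [folklore] -/
theorem index_ker {d : ℕ} [NeZero d] (θ : CyclicCharacter G d) : θ.ker.index = d := by
  have hker : θ.toMonoidHom.ker = θ.ker := by
    ext g
    rw [MonoidHom.mem_ker, CyclicCharacter.mem_ker]
    exact ⟨fun h => Multiplicative.ofAdd.injective h, fun h => congrArg Multiplicative.ofAdd h⟩
  have hrange : θ.toMonoidHom.range = ⊤ :=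
    MonoidHom.range_eq_top.2 fun x => by
      obtain ⟨g, hg⟩ := θ.surjective (Multiplicative.toAdd x)
      refine ⟨g, ?_⟩
      change Multiplicative.ofAdd (θ g) = x
      rw [hg]
      rfl
  rw [← hker, Subgroup.index_ker, hrange, Subgroup.card_top, Nat.card_eq_fintype_card,
    Fintype.card_multiplicative, ZMod.card]

/-- **`e = (H : φ⁻¹(ker χ))`.** [folklore] -/
theorem compOrder_eq_index : χ.compOrder φ = (χ.ker.comap (φ : H →* G)).index := by
  rw [← ker_derived, index_ker]

end CyclicCharacter

/-! ### Restriction of cyclic classes -/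

section Restrict

variable {G : Type u} [Group G] [TopologicalSpace G] [IsTopologicalGroup G] [LocallyCompactSpace G]
variable {H : Type u} [Group H] [TopologicalSpace H] [IsTopologicalGroup H] [LocallyCompactSpace H]
variable {n : ℕ} [NeZero n] (χ : CyclicCharacter G n) (φ : H →ₜ* G)
variable {A : Type u} [AddCommGroup A] [TopologicalSpace A] [DiscreteTopology A]
variable (ρ : ContinuousRep G ℤ A) (ρ' : ContinuousRep H ℤ A)

/-- **Restriction of a cyclic class is the cyclic class of the derived character**: for a pair
`(φ : H → G, f : A → A)` with `f` the identity on the underlying group,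
`H²(φ, f)(κ_χ(a)) = κ_ψ(a)`, `ψ` the derived character of `χ ∘ φ` (`carryFun_derived`).
[cite: SerreLocalFields1979, XIII §3 Prop. 7; SerreGaloisCohomology1997, I §2.4] -/
theorem map_cyclicClass_eq_cyclicClass_derived
    (f : TopRep.res ((φ : H →ₜ* G) : H →* G) ρ.toTopRep ⟶ ρ'.toTopRep) (hf : ∀ v, f.hom v = v)
    (a : ρ.toTopRep.ρ.invariants) (a' : ρ'.toTopRep.ρ.invariants) (haa : (a' : A) = a) :
    ContinuousCohomology.map φ f 2 (cyclicClass χ ρ a) = cyclicClass (χ.derived φ) ρ' a' := by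
  rw [cyclicClass_apply, cyclicClass_apply, map_twoCocycleClass]
  refine congrArg _ (Subtype.ext (ContinuousMap.ext fun q => ?_))
  obtain ⟨σ, τ⟩ := q
  rw [contTwoCocycles.pullback_apply, carryCocycle_apply, carryCocycle_apply, hf,
    χ.carryFun_derived φ, haa]

end Restrict

end Literature.NumberTheory.GaloisRepresentations

end
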